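import Mathlib
import Summits.Ventures.HodgeRepro.Tier4.Target
import Summits.Ventures.HodgeRepro.Tier4.Common.TargetData
import Summits.Ventures.HodgeRepro.Tier4.Line4.MixedTransfer
import Summits.Ventures.HodgeRepro.Tier4.Line4.MixedInvariant
import Summits.Ventures.HodgeRepro.Tier4.Line4.Forms11
import Summits.Ventures.HodgeRepro.Tier4.Line4.MixedClosed
import Summits.Ventures.HodgeRepro.Tier4.Line4.PairDescends
import Summits.Ventures.HodgeRepro.Tier4.Line4.TwoTorusCut
import Summits.Ventures.HodgeRepro.Tier4.LitCompactness
import Summits.Ventures.HodgeRepro.Tier4.Common.FundamentalDomain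
import Summits.Ventures.HodgeRepro.Tier4.Common.ProperlyDiscontinuous
import Summits.Ventures.HodgeRepro.Tier4.Common.MixedPlane
import Summits.Ventures.HodgeRepro.Tier4.Common.MixedPlaneKType
import Summits.Ventures.HodgeRepro.Tier4.Common.MixedPlaneCusp
import Summits.Ventures.HodgeRepro.Tier4.Common.RowPlane
import Summits.Ventures.HodgeRepro.Tier4.Common.LocalTorus
import Summits.Ventures.HodgeRepro.Tier4.Common.KTypeSpace
import Summits.Ventures.HodgeRepro.Tier4.Common.SettingOfData
import Summits.Ventures.HodgeRepro.Tier4.Line1.RTFSetting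
import Summits.Ventures.HodgeRepro.Tier4.Line4.PairIndependent
import Summits.Ventures.HodgeRepro.Tier4.Line4.RieszOnKType
import Summits.Ventures.HodgeRepro.Tier4.Line4.RieszOnSetting
import Summits.Ventures.HodgeRepro.Tier4.Line4.TransportSelfAdjoint
import Summits.Ventures.HodgeRepro.Tier4.Line4.SeesawDefinite
import Summits.Ventures.HodgeRepro.Tier4.Line4.SeesawDistribution
import Summits.Ventures.HodgeRepro.Tier4.Line4.W3ReductionGeneric
import Summits.Ventures.HodgeRepro.Tier4.Line4.W3OfAdaptedGeneric
import Summits.Ventures.HodgeRepro.Tier4.Line4.W3TwoVector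
import Summits.Ventures.HodgeRepro.Tier4.Line4.ConjStability
import Summits.Ventures.HodgeRepro.Tier4.TargetV3
import Summits.Ventures.HodgeRepro.Tier4.Common.TargetDataV3

/-! # LINE L4 — CLOSE FORM, kernel-minimal gate module (R-38 lead S15981 · R-40 lead S16190 (2))

The transitive dependency closure of `target_L4v3_of_inputs` restricted to the declarations NOT on the tree, copied
BYTE-IDENTICAL (declarations and docstrings) from the one-file close form of record CloseForm-v0.44 (sha256 973e34caa6554b4e1327fd10dbe9dd921bd0b4f0e6a23a479b7bebf9c0c2c0bb · 3342 lines · 377540 B)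
(HOME proofs/t4-plan-4/Tier4/Line4/CloseForm.lean, the regeneration of the installed skeleton v0.44 with every sorried
display replaced by a named `Input_*` Prop).  Contents: the defined `(1,1)`-cohomology quotient `H11`, the class map
`cls11`, the pairing on classes `inter11`, the three lemmas `pair11_onBall` / `inter11_cls11` / `mixed_mem_Z11`,
`exists_domain`, the ONE input of the target's cone `Input_mixed_classes_pair_v3` (NOT A PRINT — the disclosed costume of
L4.3b′ at v3, open mathematics), the assembly `conclusionAt_of_content_v3` and `target_L4v3_of_inputs`.

READING OF RECORD (R-38): `target_L4v3_of_inputs (hIn : ∀ F E … d, Input_mixed_classes_pair_v3 d) (hK : ∀ E …,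
Lit.BorelHarishChandra1962_Thm11_8_cocompact_hdef E H τ₀ C) : P_T4v3` is a sorry-free `Inputs → P_T4v3`; its kernel
cone is `hIn` (NOT A PRINT) + `hK` (PRINT, Borel–Harish-Chandra 1962 Thm 11.8, `Tier4/LitCompactness`) + the tree theorem
`properlyDiscontinuous_hdef_holds`.  It makes NO claim on `P_T4v3`.  The analytic content of the line (the wall
`mixed_two_torus` on the display inputs (8) (7a) (7b)) is not in this cone and stays in the HOME close form.

HC_CM is NOT proved by anyone in this repository; nothing here says anything about it. -/

noncomputable section

open Matrix MeasureTheory NumberField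
open scoped ComplexConjugate ComplexOrder Pointwise

namespace Summit.Ventures.HodgeRepro.Tier4.Line4

open Summit.Ventures.HodgeRepro.Tier4

variable {F E : Type} [Field F] [NumberField F] [IsGalois ℚ F] [IsCMField F]
  [Field E] [NumberField E] [IsGalois ℚ E] [IsCMField E] (d : TargetData F E)

/-- **`H^{1,1}(X_{Γ′})`** as a DEFINED Mathlib quotient: cocycles modulo coboundaries. -/
abbrev H11 (Γ' : Set (Matrix (Fin 3) (Fin 3) E)) : Type :=
  ↥(Z11 d Γ') ⧸ (Submodule.comap (Z11 d Γ').subtype (B11 d Γ'))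

/-- The class of a `(1,1)`-form (`0` if its restriction to the ball is not a cocycle). -/
def cls11 (Γ' : Set (Matrix (Fin 3) (Fin 3) E)) (ξ : Forms11) : H11 d Γ' :=
  open Classical in if hξ : onBall ξ ∈ Z11 d Γ' then Submodule.Quotient.mk ⟨onBall ξ, hξ⟩ else 0

/-- The intersection pairing on classes, through chosen representatives (well-definedness = Stokes, `pair11_descends`). -/
def inter11 (Γ' : Set (Matrix (Fin 3) (Fin 3) E)) (D : Set (Fin 2 → ℂ)) (x y : H11 d Γ') : ℂ :=
  pair11 D (Quotient.out x).1 (Quotient.out y).1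

/-- `pair11` over a fundamental domain (inside the ball) only sees the restrictions to the ball. -/
theorem pair11_onBall (Γ' : Set (Matrix (Fin 3) (Fin 3) E)) (D : Set (Fin 2 → ℂ)) (hD : d.IsDomain Γ' D)
    (ξ ξ' : Forms11) : pair11 D (onBall ξ) (onBall ξ') = pair11 D ξ ξ' := by
  have hD' : MeasurableSet D ∧ D ⊆ ball ∧ (∀ᵐ z ∂(volume.restrict ball), ∃ φ ∈ ballActions d.τ₀ d.C Γ', φ z ∈ D) ∧
      (∀ φ ∈ ballActions d.τ₀ d.C Γ', ∀ ψ ∈ ballActions d.τ₀ d.C Γ', φ ≠ ψ → volume (φ '' D ∩ ψ '' D) = 0) := hD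
  obtain ⟨hmeas, hsub, -, -⟩ := hD'
  unfold pair11
  refine MeasureTheory.setIntegral_congr_fun hmeas (fun z hz => ?_)
  have hzb : z ∈ ball := hsub hz
  simp only [onBall, hzb, if_true]

/-- `inter11` of the classes of two cocycles is their `pair11` (from `pair11_descends`: the chosen representatives differ
from the restrictions of `ξ, ξ'` by coboundaries; `pair11_onBall`). -/
theorem inter11_cls11 (hK : Lit.BorelHarishChandra1962_Thm11_8_cocompact_hdef E d.H d.τ₀ d.C)
    (hP : Lit.BorelHarishChandra1962_properlyDiscontinuous_hdef E d.H d.τ₀ d.C)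
    (Γ' : Set (Matrix (Fin 3) (Fin 3) E)) (hΓ' : d.IsLevel Γ') (D : Set (Fin 2 → ℂ))
    (hD : d.IsDomain Γ' D) (ξ ξ' : Forms11) (hξ : onBall ξ ∈ Z11 d Γ') (hξ' : onBall ξ' ∈ Z11 d Γ') :
    inter11 d Γ' D (cls11 d Γ' ξ) (cls11 d Γ' ξ') = pair11 D ξ ξ' := by
  have key : ∀ (ζ : Forms11) (hζ : onBall ζ ∈ Z11 d Γ'),
      ∃ β : Forms11, β ∈ B11 d Γ' ∧ (Quotient.out (cls11 d Γ' ζ)).1 = onBall ζ + β := by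
    intro ζ hζ
    have hc : cls11 d Γ' ζ = Submodule.Quotient.mk ⟨onBall ζ, hζ⟩ := by
      unfold cls11
      rw [dif_pos hζ]
    have hout : Submodule.Quotient.mk (Quotient.out (cls11 d Γ' ζ)) = cls11 d Γ' ζ := Quotient.out_eq _
    rw [hc] at hout
    have hmem : Quotient.out (Submodule.Quotient.mk (p := Submodule.comap (Z11 d Γ').subtype (B11 d Γ'))
        (⟨onBall ζ, hζ⟩ : ↥(Z11 d Γ'))) - ⟨onBall ζ, hζ⟩ ∈
        Submodule.comap (Z11 d Γ').subtype (B11 d Γ') := (Submodule.Quotient.eq _).mp hout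
    refine ⟨(Quotient.out (Submodule.Quotient.mk (p := Submodule.comap (Z11 d Γ').subtype (B11 d Γ'))
        (⟨onBall ζ, hζ⟩ : ↥(Z11 d Γ'))) - ⟨onBall ζ, hζ⟩).1, ?_, ?_⟩
    · have := Submodule.mem_comap.mp hmem
      simpa [Submodule.subtype_apply] using this
    · rw [hc]
      simp
  obtain ⟨β, hβ, hβeq⟩ := key ξ hξ
  obtain ⟨β', hβ', hβeq'⟩ := key ξ' hξ'
  unfold inter11
  rw [hβeq, hβeq', pair11_descends d hK hP Γ' hΓ' D hD _ _ hξ hξ' β β' hβ hβ', pair11_onBall d Γ' D hD]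

/-- The mixed forms are cocycles (from L4.1, L4.2, L4.2′): their restrictions to the ball lie in `Z11`. -/
theorem mixed_mem_Z11 (Γ' : Set (Matrix (Fin 3) (Fin 3) E)) (hΓ' : d.IsLevel Γ') (h : Fin 4 → HeckeElement E)
    (hh : d.IsHeckeFor Γ' h) : onBall (ξ₁₃ d h) ∈ Z11 d Γ' ∧ onBall (ξ₂₄ d h) ∈ Z11 d Γ' := by
  obtain ⟨hi₁, hi₂⟩ := mixed_invariant d Γ' hΓ' h hh
  obtain ⟨hc₁, hc₂⟩ := mixed_closed d Γ' hΓ' h hh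
  obtain ⟨hs₁, hs₂⟩ := mixed_smooth d Γ' hΓ' h hh
  exact ⟨Submodule.subset_span ⟨_, hs₁, hc₁, hi₁, rfl⟩, Submodule.subset_span ⟨_, hs₂, hc₂, hi₂, rfl⟩⟩

/-- Every level has a fundamental domain — CLOSED by t4-L4-p1's unconditional construction
`TargetData.exists_domain` (`Common/FundamentalDomain`, p665357: the key-minimal transversal of the discrete
action; no BHC input), restated here by name so the assembly below reads as before. -/
theorem exists_domain (Γ' : Set (Matrix (Fin 3) (Fin 3) E)) (hΓ' : d.IsLevel Γ') :
    ∃ D : Set (Fin 2 → ℂ), d.IsDomain Γ' D :=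
  d.exists_domain Γ' hΓ'

/-- **L4.3b′ at v3 (the costume, v3 twin)**: for the datum `d` there are a deeper level `Γ'`, N2-compatible Albanese lifts
`a'` at `Γ'` into the same tori, and — on the re-levelled datum — for every fundamental domain of `Γ'` a Hecke quadruple of
level `Γ'` with non-zero mixed intersection number.  Declared `sorry` (skeleton file); its content is the wall
`mixed_two_torus_W3` plus the N2 bookkeeping of the seesaw constituents' central characters. -/
def Input_mixed_classes_pair_v3 : Prop :=
    ∃ (Γ' : Set (Matrix (Fin 3) (Fin 3) E)) (hΓ' : d.IsLevel Γ')
      (a' : ∀ i : Fin 4, (Fin 2 → ℂ) → (↥(d.T i) → ℂ))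
      (ha' : ∀ i, IsAlbaneseLift (d.T i) (d.Λ i) d.τ₀ d.C Γ' (a' i)),
      (d.relevel Γ' hΓ'.1 a' ha').N2 ∧
      ∀ D : Set (Fin 2 → ℂ), (d.relevel Γ' hΓ'.1 a' ha').IsDomain Γ' D →
        ∃ (h : Fin 4 → HeckeElement E), (d.relevel Γ' hΓ'.1 a' ha').IsHeckeFor Γ' h ∧
          inter11 (d.relevel Γ' hΓ'.1 a' ha') Γ' D
            (cls11 (d.relevel Γ' hΓ'.1 a' ha') Γ' (ξ₁₃ (d.relevel Γ' hΓ'.1 a' ha') h))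
            (cls11 (d.relevel Γ' hΓ'.1 a' ha') Γ' (ξ₂₄ (d.relevel Γ' hΓ'.1 a' ha') h)) ≠ 0

/-- The v3 conclusion for the datum `d` — a deeper level, N2-lifts at it, and `conclusionAt` there — from
`mixed_classes_pair_v3` and the §4 chain applied to the re-levelled datum (sorry-free). -/
theorem conclusionAt_of_content_v3 (hIn : Input_mixed_classes_pair_v3 d) (hK : Lit.BorelHarishChandra1962_Thm11_8_cocompact_hdef E d.H d.τ₀ d.C)
    (hP : Lit.BorelHarishChandra1962_properlyDiscontinuous_hdef E d.H d.τ₀ d.C) :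
    ∃ (Γ' : Set (Matrix (Fin 3) (Fin 3) E)) (hΓ' : d.IsLevel Γ')
      (a' : ∀ i : Fin 4, (Fin 2 → ℂ) → (↥(d.T i) → ℂ))
      (ha' : ∀ i, IsAlbaneseLift (d.T i) (d.Λ i) d.τ₀ d.C Γ' (a' i)),
      (d.relevel Γ' hΓ'.1 a' ha').N2 ∧ (d.relevel Γ' hΓ'.1 a' ha').conclusionAt Γ' := by
  obtain ⟨Γ', hΓ', a', ha', hN2, hpair⟩ := hIn
  have hΓ'' : (d.relevel Γ' hΓ'.1 a' ha').IsLevel Γ' := ⟨hΓ'.1, subset_rfl⟩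
  obtain ⟨D, hD⟩ := exists_domain (d.relevel Γ' hΓ'.1 a' ha') Γ' hΓ''
  obtain ⟨h, hh, hne⟩ := hpair D hD
  refine ⟨Γ', hΓ', a', ha', hN2, h, hh, D, hD, ?_⟩
  rw [pairing_eq_neg_mixedPairing, mixedPairing_eq_pair11]
  refine neg_ne_zero.mpr ?_
  obtain ⟨hz₁, hz₂⟩ := mixed_mem_Z11 (d.relevel Γ' hΓ'.1 a' ha') Γ' hΓ'' h hh
  rw [← inter11_cls11 (d.relevel Γ' hΓ'.1 a' ha') hK hP Γ' hΓ'' D hD _ _ hz₁ hz₂]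
  exact hne

/-- **LINE L4 closes the SUCCESSOR target `P_T4v3` BY NAME** from the same ONE printed input as `target_L4`
(Borel–Harish-Chandra Thm 11.8, `Tier4/LitCompactness.lean`), through `P_T4v3_of_forall` — FILED as v0.27 (S14239). -/
theorem target_L4v3_of_inputs
    (hIn : ∀ (F E : Type) [Field F] [NumberField F] [IsGalois ℚ F] [IsCMField F] [Field E] [NumberField E]
      [IsGalois ℚ E] [IsCMField E] (d : TargetData F E), Input_mixed_classes_pair_v3 d)
    (hK : ∀ (E : Type) [Field E] [NumberField E] [IsCMField E] (H : Matrix (Fin 3) (Fin 3) E) (τ₀ : E →+* ℂ)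
      (C : Matrix (Fin 3) (Fin 3) ℂ), Lit.BorelHarishChandra1962_Thm11_8_cocompact_hdef E H τ₀ C) :
    Summit.Ventures.HodgeRepro.Tier4.P_T4v3 :=
  P_T4v3_of_forall fun F E _ _ _ _ _ _ _ _ d =>
    conclusionAt_of_content_v3 d (hIn F E d) (hK E d.H d.τ₀ d.C) (properlyDiscontinuous_hdef_holds E d.H d.τ₀ d.C)

end Summit.Ventures.HodgeRepro.Tier4.Line4
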